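import Literature.Analysis.FluidPDE.SteadyNavierStokesEnergy
import Literature.Analysis.FluidPDE.SteadyNavierStokesProofs
import Literature.Analysis.FunctionSpaces.TorusFluidGlueProofs

/-!
# Stub `stub_truncationResidual` of line `lojasiewicz-lamb-floor-ladder`
# (crux stmt-AnomalousDissipation-13038, `TaylorCertificates.SteadyStatesLoudBounded`)

**Fourier truncations of a finite-enstrophy standing Euler flow are approximate standing flows,
with residuals vanishing in the dual norm over the test class.**  Let `f` be smooth and let
`U ∈ V = H ∩ H¹(T³)` be a weak steady Euler state of `f`
(`Torus.IsSteadyWeakSolution 0 f U`: `(f, w) + ∫ (U ⊗ U) : ∇w = 0` for all smooth divergence-free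
mean-zero `w`).  Then the truncations `U_N := P_N U` (`Torus.fourierTruncate`; smooth and
divergence free) satisfy `|∫ ⟪(U_N·∇)U_N − f, w⟫| ≤ r_N ‖∇w‖₂` for every admissible test `w`, with
`r_N ≥ 0`, `r_N → 0` independent of `w`.

Proof.  By antisymmetry of the trilinear form (`Torus.integral_inner_convect_eq_neg`,
Temam 1984, Ch. II Lemma 1.3) `∫ ⟪(U_N·∇)U_N, w⟫ = −∫ ⟪U_N, (U_N·∇)w⟫`, and by the standing identity
`(f, w) = −∫ ⟪U, (U·∇)w⟫`; hence the residual is `∫ (⟪U, Dw·U⟫ − ⟪U_N, Dw·U_N⟫)`, whose integrand is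
bounded by `‖Dw‖ (2‖U‖‖U_N − U‖ + ‖U_N − U‖²)`.  Hölder twice (exactly as in
`Torus.enorm_inertialPairing_fourierTruncate_sq_le`, Temam 1979, Ch. II Lemma 1.2 / (1.13)) gives
`|…| ≤ ‖Dw‖_{L²} (2 ‖U‖_{L⁴} ‖U_N − U‖_{L⁴} + ‖U_N − U‖²_{L⁴})` with `‖Dw‖²_{L²} ≤ 3 ‖∇w‖²₂`
(`Torus.lintegral_enorm_fderiv_sq_le_card_mul_eGradNormSq`), and `‖U_N − U‖_{L⁴} → 0` by the
Sobolev embedding `H¹(T³) ⊂ L⁴(T³)` (`Torus.lintegral_enorm_pow_four_le_eSobolevNorm`) applied to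
the spectral tail `‖P_N U − U‖²_{H¹} = ∑_{|k|>N} ⟨k⟩² ‖Û(k)‖² → 0` (`Torus.tendsto_sobolev_tail`).
All estimates are run in `ℝ≥0∞` and passed to real numbers at the end; the residual scale is
`r_N = √3 · (2 (B^{1/2} T_N^{1/2})^{1/2} + T_N^{1/2})` with `B = ∫ ‖U‖⁴`, `T_N = ∫ ‖U_N − U‖⁴`.
-/

-- `Summit.<Summit>.<Problem>` is the tree's mandated summit-side namespace (CONVENTIONS §2); for this
-- single-conjunct summit the two coincide, so the duplicate is deliberate.
set_option linter.dupNamespace false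

noncomputable section

namespace Summit.AnomalousDissipation.AnomalousDissipation.Theorems.SteadyStatesLoudBounded.TruncationResidual

open MeasureTheory Filter Topology UnitAddTorus
open scoped InnerProductSpace RealInnerProductSpace ENNReal NNReal
open Literature.Analysis.FunctionSpaces Literature.Analysis.FluidPDE

/-! ## Pointwise algebra and Cauchy–Schwarz -/

-- adapted from Literature/Analysis/FluidPDE/SteadyNavierStokesEnergy.lean (`lintegral_mul_le_sqrt`)
/-- Cauchy–Schwarz for lower integrals: `∫ f g ≤ (∫ f²)^{1/2} (∫ g²)^{1/2}` (Mathlib's Hölder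
inequality `ENNReal.lintegral_mul_le_Lp_mul_Lq` with `p = q = 2`). [folklore] -/
theorem lintegral_mul_le_sqrt {α : Type*} [MeasurableSpace α] (μ : Measure α)
    {f g : α → ℝ≥0∞} (hf : AEMeasurable f μ) (hg : AEMeasurable g μ) :
    ∫⁻ x, f x * g x ∂μ ≤ (∫⁻ x, f x ^ 2 ∂μ) ^ (1 / 2 : ℝ) * (∫⁻ x, g x ^ 2 ∂μ) ^ (1 / 2 : ℝ) := by
  have h := ENNReal.lintegral_mul_le_Lp_mul_Lq μ Real.HolderConjugate.two_two hf hg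
  simpa only [ENNReal.rpow_two, Pi.mul_apply] using h

/-- The quadratic form `a ↦ ⟪a, L a⟫` of a bounded operator is locally Lipschitz with the explicit
bound `|⟪a, L a⟫ − ⟪b, L b⟫| ≤ ‖L‖ (2‖a‖‖b − a‖ + ‖b − a‖²)`
(`⟪a, L a⟫ − ⟪b, L b⟫ = ⟪a − b, L a⟫ + ⟪b, L (a − b)⟫` and `‖b‖ ≤ ‖a‖ + ‖b − a‖`). [folklore] -/
theorem norm_inner_apply_sub_le {E : Type*} [NormedAddCommGroup E] [InnerProductSpace ℝ E]
    (L : E →L[ℝ] E) (a b : E) :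
    ‖⟪a, L a⟫_ℝ - ⟪b, L b⟫_ℝ‖ ≤ ‖L‖ * (2 * (‖a‖ * ‖b - a‖) + ‖b - a‖ ^ 2) := by
  have hsplit : ⟪a, L a⟫_ℝ - ⟪b, L b⟫_ℝ = ⟪a - b, L a⟫_ℝ + ⟪b, L (a - b)⟫_ℝ := by
    rw [map_sub, inner_sub_left, inner_sub_right]
    ring
  have hb : ‖b‖ ≤ ‖a‖ + ‖b - a‖ :=
    calc ‖b‖ = ‖a + (b - a)‖ := by rw [add_sub_cancel]
      _ ≤ ‖a‖ + ‖b - a‖ := norm_add_le _ _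
  have h1 : ‖⟪a - b, L a⟫_ℝ‖ ≤ ‖b - a‖ * (‖L‖ * ‖a‖) :=
    (norm_inner_le_norm (a - b) (L a)).trans
      (mul_le_mul (norm_sub_rev a b).le (L.le_opNorm a) (norm_nonneg _) (norm_nonneg _))
  have h2 : ‖⟪b, L (a - b)⟫_ℝ‖ ≤ (‖a‖ + ‖b - a‖) * (‖L‖ * ‖b - a‖) :=
    (norm_inner_le_norm b (L (a - b))).trans
      (mul_le_mul hb ((L.le_opNorm _).trans_eq (by rw [norm_sub_rev])) (norm_nonneg _)
        (by positivity))
  calc ‖⟪a, L a⟫_ℝ - ⟪b, L b⟫_ℝ‖ = ‖⟪a - b, L a⟫_ℝ + ⟪b, L (a - b)⟫_ℝ‖ := by rw [hsplit]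
    _ ≤ ‖⟪a - b, L a⟫_ℝ‖ + ‖⟪b, L (a - b)⟫_ℝ‖ := norm_add_le _ _
    _ ≤ ‖b - a‖ * (‖L‖ * ‖a‖) + (‖a‖ + ‖b - a‖) * (‖L‖ * ‖b - a‖) := add_le_add h1 h2
    _ = ‖L‖ * (2 * (‖a‖ * ‖b - a‖) + ‖b - a‖ ^ 2) := by ring

/-- The bound `norm_inner_apply_sub_le` in `ℝ≥0∞`. [folklore] -/
theorem enorm_inner_apply_sub_le {E : Type*} [NormedAddCommGroup E] [InnerProductSpace ℝ E]
    (L : E →L[ℝ] E) (a b : E) :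
    ‖⟪a, L a⟫_ℝ - ⟪b, L b⟫_ℝ‖ₑ ≤ ‖L‖ₑ * (2 * (‖a‖ₑ * ‖b - a‖ₑ) + ‖b - a‖ₑ ^ 2) := by
  have h : ‖⟪a, L a⟫_ℝ - ⟪b, L b⟫_ℝ‖₊ ≤ ‖L‖₊ * (2 * (‖a‖₊ * ‖b - a‖₊) + ‖b - a‖₊ ^ 2) := by
    rw [← NNReal.coe_le_coe]
    push_cast
    exact norm_inner_apply_sub_le L a b
  simp only [enorm_eq_nnnorm]
  exact_mod_cast h

/-! ## The `L⁴` estimate of the residual integrand (Hölder twice) -/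

/-- **The difference of the convective pairings of two fields against a smooth test, through `L⁴`**:
for measurable `u`, `v` and smooth `w` on `T^d`,
`‖∫ (⟪u, Dw·u⟫ − ⟪v, Dw·v⟫)‖ ≤ (d ‖∇w‖²₂)^{1/2} · (2 (‖u‖²_{L⁴} ‖v − u‖²_{L⁴})^{1/2} + ‖v − u‖²_{L⁴})`
in `ℝ≥0∞` (pointwise `norm_inner_apply_sub_le`, then Hölder twice and `∫ ‖Dw‖² ≤ d ‖∇w‖²₂`,
`Torus.lintegral_enorm_fderiv_sq_le_card_mul_eGradNormSq`) — the estimate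
`|b(u, v, w)| ≤ c ‖u‖_{L⁴} ‖v‖ ‖w‖_{L⁴}` of Temam 1979, Ch. II Lemma 1.2 / (1.13).
[cite: Temam1979, Ch. II §1.1 Lemma 1.2, (1.13)] -/
theorem enorm_integral_inner_convect_sub_le {d : Type*} [Fintype d] [DecidableEq d]
    {u v w : UnitAddTorus d → EuclideanSpace ℝ d}
    (hu : AEStronglyMeasurable u volume) (hv : AEStronglyMeasurable v volume)
    (hw : Torus.IsSmooth w) :
    ‖∫ x, (⟪u x, Torus.convect u w x⟫_ℝ - ⟪v x, Torus.convect v w x⟫_ℝ)‖ₑ ≤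
      (Fintype.card d * Torus.eGradNormSq w) ^ (1 / 2 : ℝ) *
        (2 * ((∫⁻ x, ‖u x‖ₑ ^ 4) ^ (1 / 2 : ℝ) * (∫⁻ x, ‖v x - u x‖ₑ ^ 4) ^ (1 / 2 : ℝ)) ^ (1 / 2 : ℝ) +
          (∫⁻ x, ‖v x - u x‖ₑ ^ 4) ^ (1 / 2 : ℝ)) := by
  -- ### pointwise bound of the integrand (`convect u w x = Dw(x) (u x)` by `rfl`)
  have hpt : ∀ x, ‖⟪u x, Torus.convect u w x⟫_ℝ - ⟪v x, Torus.convect v w x⟫_ℝ‖ₑ ≤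
      2 * (‖Torus.fderiv w x‖ₑ * (‖u x‖ₑ * ‖v x - u x‖ₑ)) +
        ‖Torus.fderiv w x‖ₑ * ‖v x - u x‖ₑ ^ 2 := fun x =>
    calc ‖⟪u x, Torus.convect u w x⟫_ℝ - ⟪v x, Torus.convect v w x⟫_ℝ‖ₑ
        ≤ ‖Torus.fderiv w x‖ₑ * (2 * (‖u x‖ₑ * ‖v x - u x‖ₑ) + ‖v x - u x‖ₑ ^ 2) :=
          enorm_inner_apply_sub_le (Torus.fderiv w x) (u x) (v x)
      _ = _ := by ring
  -- ### measurability
  have hLm : AEMeasurable (fun x => ‖Torus.fderiv w x‖ₑ) volume :=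
    (Literature.Analysis.FluidPDE.Torus.continuous_fderiv_of_isSmooth
      hw).aestronglyMeasurable.aemeasurable.enorm
  have hum : AEMeasurable (fun x => ‖u x‖ₑ) volume := hu.aemeasurable.enorm
  have hem : AEMeasurable (fun x => ‖v x - u x‖ₑ) volume := (hv.sub hu).aemeasurable.enorm
  set A : ℝ≥0∞ := ∫⁻ x, ‖Torus.fderiv w x‖ₑ ^ 2 with hA
  set B : ℝ≥0∞ := ∫⁻ x, ‖u x‖ₑ ^ 4 with hB
  set T : ℝ≥0∞ := ∫⁻ x, ‖v x - u x‖ₑ ^ 4 with hT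
  have hprod : AEMeasurable (fun x => ‖u x‖ₑ * ‖v x - u x‖ₑ) volume := hum.fun_mul hem
  have hmix : AEMeasurable (fun x => ‖Torus.fderiv w x‖ₑ * (‖u x‖ₑ * ‖v x - u x‖ₑ)) volume :=
    hLm.fun_mul hprod
  have hmix2 : AEMeasurable (fun x => 2 * (‖Torus.fderiv w x‖ₑ * (‖u x‖ₑ * ‖v x - u x‖ₑ))) volume :=
    hmix.const_mul 2
  have h4 : ∀ y : ℝ≥0∞, (y ^ 2) ^ 2 = y ^ 4 := fun y => by rw [← pow_mul]
  -- ### Hölder twice for the mixed term, once for the quadratic term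
  have hH1 : ∫⁻ x, ‖Torus.fderiv w x‖ₑ * (‖u x‖ₑ * ‖v x - u x‖ₑ) ≤
      A ^ (1 / 2 : ℝ) * (B ^ (1 / 2 : ℝ) * T ^ (1 / 2 : ℝ)) ^ (1 / 2 : ℝ) := by
    have h1 := lintegral_mul_le_sqrt volume hLm hprod
    have h2 : ∫⁻ x, (‖u x‖ₑ * ‖v x - u x‖ₑ) ^ 2 ≤ B ^ (1 / 2 : ℝ) * T ^ (1 / 2 : ℝ) := by
      have h := lintegral_mul_le_sqrt volume (hum.pow_const 2) (hem.pow_const 2)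
      simp only [h4] at h
      refine (le_of_eq (lintegral_congr fun x => ?_)).trans h
      ring
    exact h1.trans (mul_le_mul' le_rfl (ENNReal.rpow_le_rpow h2 (by norm_num)))
  have hH2 : ∫⁻ x, ‖Torus.fderiv w x‖ₑ * ‖v x - u x‖ₑ ^ 2 ≤ A ^ (1 / 2 : ℝ) * T ^ (1 / 2 : ℝ) := by
    have h := lintegral_mul_le_sqrt volume hLm (hem.pow_const 2)
    simp only [h4] at h
    exact h
  -- ### `A ≤ d ‖∇w‖²`
  have hAle : A ≤ Fintype.card d * Torus.eGradNormSq w :=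
    Torus.lintegral_enorm_fderiv_sq_le_card_mul_eGradNormSq hw
  -- ### assembly
  calc ‖∫ x, (⟪u x, Torus.convect u w x⟫_ℝ - ⟪v x, Torus.convect v w x⟫_ℝ)‖ₑ
      ≤ ∫⁻ x, ‖⟪u x, Torus.convect u w x⟫_ℝ - ⟪v x, Torus.convect v w x⟫_ℝ‖ₑ :=
        enorm_integral_le_lintegral_enorm _
    _ ≤ ∫⁻ x, (2 * (‖Torus.fderiv w x‖ₑ * (‖u x‖ₑ * ‖v x - u x‖ₑ)) +
          ‖Torus.fderiv w x‖ₑ * ‖v x - u x‖ₑ ^ 2) := lintegral_mono hpt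
    _ = 2 * (∫⁻ x, ‖Torus.fderiv w x‖ₑ * (‖u x‖ₑ * ‖v x - u x‖ₑ)) +
          ∫⁻ x, ‖Torus.fderiv w x‖ₑ * ‖v x - u x‖ₑ ^ 2 := by
        rw [lintegral_add_left' hmix2, lintegral_const_mul'' 2 hmix]
    _ ≤ 2 * (A ^ (1 / 2 : ℝ) * (B ^ (1 / 2 : ℝ) * T ^ (1 / 2 : ℝ)) ^ (1 / 2 : ℝ)) +
          A ^ (1 / 2 : ℝ) * T ^ (1 / 2 : ℝ) := add_le_add (mul_le_mul' le_rfl hH1) hH2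
    _ = A ^ (1 / 2 : ℝ) * (2 * (B ^ (1 / 2 : ℝ) * T ^ (1 / 2 : ℝ)) ^ (1 / 2 : ℝ) + T ^ (1 / 2 : ℝ)) := by
        ring
    _ ≤ (Fintype.card d * Torus.eGradNormSq w) ^ (1 / 2 : ℝ) *
          (2 * (B ^ (1 / 2 : ℝ) * T ^ (1 / 2 : ℝ)) ^ (1 / 2 : ℝ) + T ^ (1 / 2 : ℝ)) :=
        mul_le_mul' (ENNReal.rpow_le_rpow hAle (by norm_num)) le_rfl

/-! ## The residual identity of a truncated standing flow -/

/-- **The residual of a smooth divergence-free field `v` against the force of a standing flow `u`**: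
if `(f, w) = −∫ ⟪u, (u·∇)w⟫` (the weak steady Euler equation of `u` tested with `w`), then
`∫ ⟪(v·∇)v − f, w⟫ = ∫ (⟪u, (u·∇)w⟫ − ⟪v, (v·∇)w⟫)` by the antisymmetry
`∫ ⟪(v·∇)v, w⟫ = −∫ ⟪v, (v·∇)w⟫` (Temam 1984, Ch. II §1.2 Lemma 1.3).
[cite: Temam1984, Ch. II §1.2 Lemma 1.3] -/
theorem integral_inner_convect_sub_force_eq {d : Type*} [Fintype d] [DecidableEq d]
    {u v f w : UnitAddTorus d → EuclideanSpace ℝ d}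
    (hu : MemLp u 2 volume) (hv : Torus.IsSmooth v) (hvd : Torus.IsDivFree v)
    (hf : Torus.IsSmooth f) (hw : Torus.IsSmooth w)
    (hfw : ∫ x, ⟪f x, w x⟫_ℝ = -∫ x, ⟪u x, Torus.convect u w x⟫_ℝ) :
    ∫ x, ⟪Torus.convect v v x - f x, w x⟫_ℝ =
      ∫ x, (⟪u x, Torus.convect u w x⟫_ℝ - ⟪v x, Torus.convect v w x⟫_ℝ) := by
  have i1 : Integrable (fun x => ⟪Torus.convect v v x, w x⟫_ℝ) volume :=
    ((hv.convect hv).inner hw).integrable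
  have i2 : Integrable (fun x => ⟪f x, w x⟫_ℝ) volume := (hf.inner hw).integrable
  have i3 : Integrable (fun x => ⟪u x, Torus.convect u w x⟫_ℝ) volume :=
    Torus.integrable_inner_convect_of_memLp hu hw
  have i4 : Integrable (fun x => ⟪v x, Torus.convect v w x⟫_ℝ) volume :=
    Torus.integrable_inner_convect_of_memLp (hv.memLp 2) hw
  simp_rw [inner_sub_left]
  rw [integral_sub i1 i2, integral_sub i3 i4, Torus.integral_inner_convect_eq_neg hv hvd hv hw, hfw]
  ring

/-! ## The truncation error in `L⁴` tends to zero -/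

/-- **The `L⁴` truncation error of a field in `H¹(T^d)`, `2 ≤ d ≤ 4`, tends to zero and all the
`L⁴` quantities are finite**: for `u ∈ L²` with `‖u‖_{H¹} < ∞` there hold `∫ ‖u‖⁴ < ∞`,
`∫ ‖P_m u − u‖⁴ < ∞` and `∫ ‖P_m u − u‖⁴ → 0` (Sobolev `H¹ ⊂ L⁴`,
`Torus.lintegral_enorm_pow_four_le_eSobolevNorm`, on the spectral tail
`‖P_m u − u‖²_{H¹} = ∑_{|k|>m} ⟨k⟩² ‖û(k)‖² → 0`; Temam 1979, Ch. II Lemma 1.2).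
[cite: Temam1979, Ch. II §1.1 Lemma 1.2, (1.13)] -/
theorem lintegral_fourierTruncate_sub_pow_four {d : Type*} [Fintype d] [DecidableEq d]
    (hd2 : 2 ≤ Fintype.card d) (hd4 : Fintype.card d ≤ 4)
    {u : UnitAddTorus d → EuclideanSpace ℝ d} (hmem : MemLp u 2 volume)
    (hHfin : Torus.eSobolevNorm 1 (EuclideanSpace.complexify ∘ u) ≠ ⊤) :
    (∫⁻ x, ‖u x‖ₑ ^ 4) ≠ ⊤ ∧
      (∀ m : ℕ, (∫⁻ x, ‖Torus.fourierTruncate m u x - u x‖ₑ ^ 4) ≠ ⊤) ∧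
        Tendsto (fun m : ℕ => ∫⁻ x, ‖Torus.fourierTruncate m u x - u x‖ₑ ^ 4) atTop (𝓝 0) := by
  obtain ⟨K, hK⟩ := Torus.lintegral_enorm_pow_four_le_eSobolevNorm (d := d) hd2 hd4
  have hint : Integrable u volume := hmem.integrable one_le_two
  set H : ℝ≥0∞ := Torus.eSobolevNorm 1 (EuclideanSpace.complexify ∘ u) with hH
  -- the `H¹` tail
  set tail : ℕ → ℝ≥0∞ := fun m => ∑' k : {k : d → ℤ // k ∉ Torus.freqBall m},
    ENNReal.ofReal (Torus.sobolevWeight 1 (k : d → ℤ) ^ 2) *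
      ‖mFourierCoeff (EuclideanSpace.complexify ∘ u) (k : d → ℤ)‖ₑ ^ 2 with htail
  have htail0 : Tendsto tail atTop (𝓝 0) := Torus.tendsto_sobolev_tail hHfin
  have htaille : ∀ m, tail m ≤ H ^ 2 := fun m => by
    rw [hH, Torus.eSobolevNorm_one_sq_eq_tsum]
    exact ENNReal.tsum_comp_le_tsum_of_injective Subtype.val_injective _
  have hTle : ∀ m, ∫⁻ x, ‖Torus.fourierTruncate m u x - u x‖ₑ ^ 4 ≤ K * tail m ^ 2 := by
    intro m
    have h := hK (Torus.fourierTruncate m u - u) ((Torus.memLp_fourierTruncate m u 2).sub hmem)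
    rw [show Torus.eSobolevNorm 1 (EuclideanSpace.complexify ∘ (Torus.fourierTruncate m u - u)) ^ 4 =
        (Torus.eSobolevNorm 1 (EuclideanSpace.complexify ∘
          (Torus.fourierTruncate m u - u)) ^ 2) ^ 2 by rw [← pow_mul],
      Torus.eSobolevNorm_one_fourierTruncate_sub_sq hint m] at h
    exact h
  refine ⟨ne_top_of_le_ne_top (ENNReal.mul_ne_top ENNReal.coe_ne_top (ENNReal.pow_ne_top hHfin))
      (hK u hmem), fun m => ne_top_of_le_ne_top (ENNReal.mul_ne_top ENNReal.coe_ne_top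
      (ENNReal.pow_ne_top (ne_top_of_le_ne_top (ENNReal.pow_ne_top hHfin) (htaille m)))) (hTle m), ?_⟩
  have h : Tendsto (fun m => (K : ℝ≥0∞) * tail m ^ 2) atTop (𝓝 0) := by
    have := ENNReal.Tendsto.const_mul (ENNReal.Tendsto.pow (n := 2) htail0)
      (Or.inr ENNReal.coe_ne_top) (a := (K : ℝ≥0∞))
    simpa using this
  exact tendsto_of_tendsto_of_tendsto_of_le_of_le tendsto_const_nhds h (fun m => zero_le) hTle

/-! ## The stub -/

/-- **S4a `stub_truncationResidual`** — the Fourier truncations `U_N := P_N U` of a finite-enstrophy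
weak steady Euler state `U ∈ V` of the smooth force `f` are approximate standing flows: there are
`r_N ≥ 0`, `r_N → 0` (depending on `U` only) with
`|∫ ⟪(U_N·∇)U_N − f, w⟫| ≤ r_N √(gradNormSq w)` for every smooth divergence-free mean-zero `w`.
Here `r_N = √3 · (2 (‖U‖²_{L⁴} ‖U_N − U‖²_{L⁴})^{1/2} + ‖U_N − U‖²_{L⁴})` (antisymmetry of the
trilinear form, the standing identity, Hölder twice, `‖Dw‖²_{L²} ≤ 3‖∇w‖²₂`, and
`U_N → U` in `L⁴` through `H¹(T³) ⊂ L⁴(T³)`; Temam 1979, Ch. II Lemma 1.2 / (1.13)).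
[cite: Temam1979, Ch. II §1.1 Lemma 1.2, (1.13)] -/
theorem stub_truncationResidual :
    ∀ (f : UnitAddTorus (Fin 3) → EuclideanSpace ℝ (Fin 3)) (U : Torus.energySpace (Fin 3)), Torus.IsSmooth f →
      (U : Lp (EuclideanSpace ℝ (Fin 3)) 2 (volume : Measure (UnitAddTorus (Fin 3)))) ∈ Torus.energySpaceV (Fin 3) →
      Torus.IsSteadyWeakSolution 0 f U →
      ∃ r : ℕ → ℝ, (∀ N : ℕ, 0 ≤ r N) ∧ Tendsto r atTop (𝓝 0) ∧
        ∀ (N : ℕ) (w : UnitAddTorus (Fin 3) → EuclideanSpace ℝ (Fin 3)),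
          Torus.IsSmooth w → Torus.IsDivFree w → Torus.HasZeroMean w →
          |∫ x, inner ℝ (Torus.convect
              (Torus.fourierTruncate N
                ((U : Lp (EuclideanSpace ℝ (Fin 3)) 2 (volume : Measure (UnitAddTorus (Fin 3)))) :
                  UnitAddTorus (Fin 3) → EuclideanSpace ℝ (Fin 3)))
              (Torus.fourierTruncate N
                ((U : Lp (EuclideanSpace ℝ (Fin 3)) 2 (volume : Measure (UnitAddTorus (Fin 3)))) :
                  UnitAddTorus (Fin 3) → EuclideanSpace ℝ (Fin 3))) x - f x) (w x)| ≤
            r N * Real.sqrt (Torus.gradNormSq w) := by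
  intro f U hf hV hsol
  set u : UnitAddTorus (Fin 3) → EuclideanSpace ℝ (Fin 3) :=
    ((U : Lp (EuclideanSpace ℝ (Fin 3)) 2 (volume : Measure (UnitAddTorus (Fin 3)))) :
      UnitAddTorus (Fin 3) → EuclideanSpace ℝ (Fin 3)) with hu
  have hmem : MemLp u 2 volume := Lp.memLp _
  obtain ⟨hBfin, hTfin, hT0⟩ := lintegral_fourierTruncate_sub_pow_four (d := Fin 3) (by simp) (by simp)
    hmem hV.2.2.ne
  set B : ℝ≥0∞ := ∫⁻ x, ‖u x‖ₑ ^ 4 with hB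
  obtain ⟨T, hT⟩ : ∃ T : ℕ → ℝ≥0∞, ∀ m, T m = ∫⁻ x, ‖Torus.fourierTruncate m u x - u x‖ₑ ^ 4 :=
    ⟨_, fun m => rfl⟩
  simp_rw [← hT] at hTfin hT0
  -- ### the residual scale `ρ_N = 2 (B^{1/2} T_N^{1/2})^{1/2} + T_N^{1/2} → 0`
  obtain ⟨ρ, hρ⟩ : ∃ ρ : ℕ → ℝ≥0∞, ∀ m,
      ρ m = 2 * (B ^ (1 / 2 : ℝ) * T m ^ (1 / 2 : ℝ)) ^ (1 / 2 : ℝ) + T m ^ (1 / 2 : ℝ) :=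
    ⟨_, fun m => rfl⟩
  have hρfin : ∀ m, ρ m ≠ ⊤ := fun m => by
    rw [hρ m]
    exact ENNReal.add_ne_top.2 ⟨ENNReal.mul_ne_top ENNReal.ofNat_ne_top
      (ENNReal.rpow_ne_top_of_nonneg (by norm_num) (ENNReal.mul_ne_top
        (ENNReal.rpow_ne_top_of_nonneg (by norm_num) hBfin)
        (ENNReal.rpow_ne_top_of_nonneg (by norm_num) (hTfin m)))),
      ENNReal.rpow_ne_top_of_nonneg (by norm_num) (hTfin m)⟩
  have hρ0 : Tendsto ρ atTop (𝓝 0) := by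
    have h1 : Tendsto (fun m => T m ^ (1 / 2 : ℝ)) atTop (𝓝 0) := by
      have := hT0.ennrpow_const (1 / 2 : ℝ)
      rwa [ENNReal.zero_rpow_of_pos (by norm_num)] at this
    have h2 : Tendsto (fun m => (B ^ (1 / 2 : ℝ) * T m ^ (1 / 2 : ℝ)) ^ (1 / 2 : ℝ)) atTop (𝓝 0) := by
      have h := ENNReal.Tendsto.const_mul h1
        (Or.inr (ENNReal.rpow_ne_top_of_nonneg (by norm_num) hBfin)) (a := B ^ (1 / 2 : ℝ))
      rw [mul_zero] at h
      have := h.ennrpow_const (1 / 2 : ℝ)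
      rwa [ENNReal.zero_rpow_of_pos (by norm_num)] at this
    have h3 := ENNReal.Tendsto.const_mul h2 (Or.inr ENNReal.ofNat_ne_top) (a := 2)
    rw [mul_zero] at h3
    rw [show ρ = fun m => 2 * (B ^ (1 / 2 : ℝ) * T m ^ (1 / 2 : ℝ)) ^ (1 / 2 : ℝ) + T m ^ (1 / 2 : ℝ)
      from funext hρ]
    simpa using h3.add h1
  refine ⟨fun m => Real.sqrt 3 * (ρ m).toReal,
    fun m => mul_nonneg (Real.sqrt_nonneg _) ENNReal.toReal_nonneg, ?_, ?_⟩
  · -- ### `r_N → 0`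
    have h : Tendsto (fun m => (ρ m).toReal) atTop (𝓝 0) := by
      rw [← ENNReal.toReal_zero]
      exact (ENNReal.tendsto_toReal ENNReal.zero_ne_top).comp hρ0
    simpa using h.const_mul (Real.sqrt 3)
  · -- ### the residual bound
    intro N w hw hwd _hwz
    have hs : Torus.IsSmooth (Torus.fourierTruncate N u) := Torus.isSmooth_fourierTruncate N u
    have hsd : Torus.IsDivFree (Torus.fourierTruncate N u) :=
      Torus.isDivFree_fourierTruncate hmem (Torus.isWeaklyDivFree_of_mem_energySpace U.2) N
    -- the standing identity `(f, w) = -∫ ⟪u, (u·∇)w⟫`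
    have hfw : ∫ x, ⟪f x, w x⟫_ℝ = -∫ x, ⟪u x, Torus.convect u w x⟫_ℝ := by
      have h := hsol w hw hwd _hwz
      simp only [Torus.nsGeneratorPairing, zero_mul, add_zero, Torus.inertialPairing] at h
      rw [← hu] at h
      have hcomm : ∫ x, ⟪u x, Torus.convect u w x⟫_ℝ = ∫ x, ⟪Torus.fderiv w x (u x), u x⟫_ℝ :=
        integral_congr_ae (ae_of_all _ fun x => real_inner_comm _ _)
      linarith
    rw [integral_inner_convect_sub_force_eq hmem hs hsd hf hw hfw]
    -- the bound in `ℝ≥0∞`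
    have hb := enorm_integral_inner_convect_sub_le hmem.1 hs.continuous.aestronglyMeasurable hw
    have hA : ((Fintype.card (Fin 3) : ℝ≥0∞) * Torus.eGradNormSq w) ^ (1 / 2 : ℝ) =
        ENNReal.ofReal (Real.sqrt 3 * Real.sqrt (Torus.gradNormSq w)) := by
      have h3 : ((Fintype.card (Fin 3) : ℕ) : ℝ≥0∞) = ENNReal.ofReal 3 := by simp
      rw [h3, Torus.eGradNormSq_eq_ofReal_gradNormSq hw, ← ENNReal.ofReal_mul (by norm_num),
        ENNReal.ofReal_rpow_of_nonneg (mul_nonneg (by norm_num) (Torus.gradNormSq_nonneg w))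
          (by norm_num), ← Real.sqrt_eq_rpow, Real.sqrt_mul (by norm_num)]
    rw [hA, ← hB, ← hT N, ← hρ N, Real.enorm_eq_ofReal_abs, ← ENNReal.ofReal_toReal (hρfin N),
      ← ENNReal.ofReal_mul (by positivity), ENNReal.ofReal_le_ofReal_iff (by positivity)] at hb
    calc _ ≤ Real.sqrt 3 * Real.sqrt (Torus.gradNormSq w) * (ρ N).toReal := hb
      _ = Real.sqrt 3 * (ρ N).toReal * Real.sqrt (Torus.gradNormSq w) := by ring

end Summit.AnomalousDissipation.AnomalousDissipation.Theorems.SteadyStatesLoudBounded.TruncationResidual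

end
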